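import Literature.MathematicalPhysics.QuantumLattice.YangMillsSphereEnergyFlow
import Literature.MathematicalPhysics.QuantumLattice.YangMillsSphereGapInvariant
import Literature.MathematicalPhysics.QuantumLattice.YangMillsHodgeNonlinBound
import Literature.Analysis.Calculus.SphereCauchySchwarz
import Literature.Analysis.Calculus.F1Algebra
import HarnessLib

/-!
# Waldron's differential inequality for `f₁` (`□ f₁ ≤ C e f / r²`), `u = ⋆(x ∧ F)` formalism

QuantumLattice file (everything proved; no definitions, no named facts) on the proof path of
`Literature.MathematicalPhysics.QuantumLattice.Waldron2019_yangMillsFlow_flatTorus`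
(A. Waldron, Invent. math. 217 (2019)), §4.2, Proposition 4.3 / (4.11): along a smooth
`𝔲(N)`-valued solution of the Yang–Mills heat flow on `𝒯 × ℝ⁴`, at a time `t` and radius `r`
where the curvature is bounded by `ε/r²` on the solid shell `r/4 ≤ ‖w‖ ≤ 2r`
(`0 < ε ≤ ε₂(N)`), the regularized quantity
`F₁(s, ρ) = ρ √(∮_{S_ρ} ∑ₐ ‖u_a(s)‖² + δ)` (`δ > 0`; `F₁ → f₁ = ρ (∮|u|²)^{1/2} = ‖Ω‖` as `δ → 0`)
has time derivative `Fₜ`, radial derivative `F_r` and second radial derivative `F_rr` at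
`(t, r)` with

`Fₜ ≤ F_rr + F_r / r − (4 − 307 C_N ε) F₁/r² + 3√δ/r + 256 ε (∮_{S_r} ∑_{c,d} ‖F(e_c,e_d)‖²)^{1/2}`,

i.e. `□ F₁ ≤ (307 C_N ε) F₁/r² + 256 ε f/r² + 3√δ/r` with `f = r²(∮|F|²)^{1/2}` — the paper's
`□ f₁ ≤ C e f/r²` (`e ∼ ε`), up to the regularization. All inputs are in the tree: the sphere
identities (`YangMillsSphereEnergyFlow/Radial`), Lemma 3.5(a) (`sphere_covariant_gap_invariant`),
the nonlinear bound, Cauchy–Schwarz on spheres and the real algebra (`F1Algebra`).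

References: A. Waldron, Invent. math. 217 (2019), §4.2, Prop. 4.3 [Waldron2019]; [folklore].
-/

noncomputable section

open scoped RealInnerProductSpace Matrix.Norms.Frobenius Topology ContDiff BigOperators
open Set MeasureTheory Metric Filter
open Literature.Analysis.FluidPDE Literature.Analysis.Calculus Literature.Analysis.Calculus.MvPoly
  Literature.Analysis.InnerProduct

namespace Literature.MathematicalPhysics.QuantumLattice

attribute [local instance] frobeniusInnerProductSpace

variable {N : ℕ}

local notation "𝔼" => EuclideanSpace ℝ (Fin 4)
local notation "𝕓" => EuclideanSpace.basisFun (Fin 4) ℝ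
local notation "𝔤" => Matrix (Fin N) (Fin N) ℂ

/-! ### Small bridges -/

/-- `IsValuedIn (skewAdjoint)` gives `IsSkewValued`. [folklore] -/
theorem isSkewValued_of_isValuedIn {B : Connection 𝔼 𝔤} (h : B.IsValuedIn (skewAdjoint.submodule ℝ 𝔤)) :
    IsSkewValued B := fun y v => skewAdjoint.mem_iff.1 (h y v)

/-- Exchange of the triple sum with the sphere integral for `‖D_L u_a‖²`. [folklore] -/
theorem sphereIntegral_sum_angSq {B : Connection 𝔼 𝔤} (hB : ContDiff ℝ 1 B) {φ : Fin 4 → 𝔼 → 𝔤}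
    (hφ : ∀ a, ContDiff ℝ 2 (φ a)) {r : ℝ} (hr : 0 < r) :
    sphereIntegral (volume : Measure 𝔼) (fun x => ∑ i, ∑ j, ∑ a, ‖covDeriv B (φ a) x (angularField 𝕓 i j x)‖ ^ 2) r =
      ∑ i, ∑ j, ∑ a, sphereIntegral (volume : Measure 𝔼) (fun x => ‖covDeriv B (φ a) x (angularField 𝕓 i j x)‖ ^ 2) r := by
  have hHc := continuous_angSq hB hφ
  have heq : (fun x => ∑ i, ∑ j, ∑ a, ‖covDeriv B (φ a) x (angularField 𝕓 i j x)‖ ^ 2) =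
      fun x => ∑ i, ∑ j, ∑ a, angSq B φ a i j x := rfl
  rw [heq, sphereIntegral_finset_sum Finset.univ (g := fun i x => ∑ j, ∑ a, angSq B φ a i j x)
    (fun i _ => continuousOn_finsetSum _ fun j _ => continuousOn_finsetSum _ fun a _ => (hHc a i j).continuousOn) hr]
  refine Finset.sum_congr rfl fun i _ => ?_
  rw [sphereIntegral_finset_sum Finset.univ (g := fun j x => ∑ a, angSq B φ a i j x)
    (fun j _ => continuousOn_finsetSum _ fun a _ => (hHc a i j).continuousOn) hr]
  refine Finset.sum_congr rfl fun j _ => ?_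
  exact sphereIntegral_finset_sum Finset.univ (g := fun a x => angSq B φ a i j x) (fun a _ => (hHc a i j).continuousOn) hr

/-- Exchange of the sum over `a` with the sphere integral for `‖u_a‖²`. [folklore] -/
theorem sphereIntegral_sum_normSq {φ : Fin 4 → 𝔼 → 𝔤} (hφ : ∀ a, Continuous (φ a)) {r : ℝ} (hr : 0 < r) :
    sphereIntegral (volume : Measure 𝔼) (fun x => ∑ a, ‖φ a x‖ ^ 2) r =
      ∑ a, sphereIntegral (volume : Measure 𝔼) (fun x => ‖φ a x‖ ^ 2) r :=
  sphereIntegral_finset_sum Finset.univ (g := fun a x => ‖φ a x‖ ^ 2) (fun a _ => ((hφ a).norm.pow 2).continuousOn) hr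

/-- **Cauchy–Schwarz for the radial derivative datum**: `(∮ 2∑⟨φ_a, D_xφ_a⟩)² ≤ 4 ∮∑‖φ_a‖² · ∮∑‖D_xφ_a‖²`.
[folklore] -/
theorem radial_cauchySchwarz {B : Connection 𝔼 𝔤} (hB : ContDiff ℝ 1 B) {φ : Fin 4 → 𝔼 → 𝔤}
    (hφ : ∀ a, ContDiff ℝ 2 (φ a)) {r : ℝ} (hr : 0 < r) :
    (sphereIntegral (volume : Measure 𝔼) (fun x => 2 * ∑ a, ⟪φ a x, covDeriv B (φ a) x x⟫) r) ^ 2 ≤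
      4 * sphereIntegral (volume : Measure 𝔼) (fun x => ∑ a, ‖φ a x‖ ^ 2) r *
        sphereIntegral (volume : Measure 𝔼) (fun x => ∑ a, ‖covDeriv B (φ a) x x‖ ^ 2) r := by
  haveI : Nontrivial 𝔼 := inferInstance
  have hDc : ∀ a, Continuous fun x : 𝔼 => covDeriv B (φ a) x x := fun a => continuous_covDeriv_radial hB (hφ a)
  have hh : Continuous fun x : 𝔼 => 2 * ∑ a, ⟪φ a x, covDeriv B (φ a) x x⟫ :=
    continuous_const.mul (continuous_finsetSum _ fun a _ => (hφ a).continuous.inner (hDc a))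
  have hFc : Continuous fun x : 𝔼 => 4 * ∑ a, ‖φ a x‖ ^ 2 :=
    continuous_const.mul (continuous_finsetSum _ fun a _ => ((hφ a).continuous.norm).pow 2)
  have hGc : Continuous fun x : 𝔼 => ∑ a, ‖covDeriv B (φ a) x x‖ ^ 2 :=
    continuous_finsetSum _ fun a _ => ((hDc a).norm).pow 2
  have hpt : ∀ x : 𝔼, (2 * ∑ a, ⟪φ a x, covDeriv B (φ a) x x⟫) ^ 2 ≤
      (4 * ∑ a, ‖φ a x‖ ^ 2) * ∑ a, ‖covDeriv B (φ a) x x‖ ^ 2 := by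
    intro x
    have h1 : |∑ a, ⟪φ a x, covDeriv B (φ a) x x⟫| ≤ ∑ a, ‖φ a x‖ * ‖covDeriv B (φ a) x x‖ :=
      (Finset.abs_sum_le_sum_abs _ _).trans (Finset.sum_le_sum fun a _ => abs_real_inner_le_norm _ _)
    have h2 := Finset.sum_mul_sq_le_sq_mul_sq (Finset.univ : Finset (Fin 4)) (fun a => ‖φ a x‖)
      (fun a => ‖covDeriv B (φ a) x x‖)
    have h3 : (∑ a, ⟪φ a x, covDeriv B (φ a) x x⟫) ^ 2 ≤ (∑ a, ‖φ a x‖ * ‖covDeriv B (φ a) x x‖) ^ 2 :=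
      sq_le_sq' (abs_le.1 h1).1 (abs_le.1 h1).2
    nlinarith [h2, h3]
  have h := sphereIntegral_sq_le_of_sq_le_mul hh.continuousOn hFc.continuousOn hGc.continuousOn
    (fun x => by positivity) (fun x => Finset.sum_nonneg fun a _ => sq_nonneg _) hpt hr
  simp only [sphereIntegral_mul_left] at h ⊢
  linarith [h]

/-- Continuity of the nonlinearity `N_a`. [folklore] -/
theorem continuous_hodgeNonlin' {B : Connection 𝔼 𝔤} (hB : ContDiff ℝ 1 B) (a : Fin 4) :
    Continuous (hodgeNonlin 𝕓 B a) := by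
  unfold hodgeNonlin
  have hF : ∀ c d, Continuous fun x => curvature B x (𝕓 c) (𝕓 d) := fun c d =>
    (contDiff_curvature_apply (k := 0) (by rw [show ((0 : WithTop ℕ∞) + 1) = 1 by norm_num]; exact hB) _ _).continuous
  refine continuous_finsetSum _ fun b _ => continuous_finsetSum _ fun c _ => continuous_finsetSum _ fun d _ => ?_
  have hsc : Continuous fun x : 𝔼 => ((lc4 a b c d : ℤ) : ℝ) * ⟪x, 𝕓 b⟫ :=
    continuous_const.mul (continuous_id.inner continuous_const)
  refine hsc.smul (continuous_finsetSum _ fun i _ => ?_)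
  simp only [Ring.lie_def]
  exact ((hF c i).mul (hF i d)).sub ((hF i d).mul (hF c i))

/-- **From a bound `h² ≤ F G` ON THE SPHERE to `(∮ h)² ≤ ∮F · ∮G`** (`F, G ≥ 0` on the sphere).
[folklore] -/
theorem sphereIntegral_sq_le_of_sq_le_mul_sphere {h F G : 𝔼 → ℝ} (hh : ContinuousOn h {0}ᶜ)
    (hF : ContinuousOn F {0}ᶜ) (hG : ContinuousOn G {0}ᶜ) {r : ℝ} (hr : 0 < r)
    (hF0 : ∀ x, ‖x‖ = r → 0 ≤ F x) (hG0 : ∀ x, ‖x‖ = r → 0 ≤ G x)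
    (hpt : ∀ x, ‖x‖ = r → h x ^ 2 ≤ F x * G x) :
    (sphereIntegral (volume : Measure 𝔼) h r) ^ 2 ≤
      sphereIntegral (volume : Measure 𝔼) F r * sphereIntegral (volume : Measure 𝔼) G r := by
  haveI : Nontrivial 𝔼 := inferInstance
  have hsF : ContinuousOn (fun x => Real.sqrt (F x)) {0}ᶜ := hF.sqrt
  have hsG : ContinuousOn (fun x => Real.sqrt (G x)) {0}ᶜ := hG.sqrt
  have habs : ∀ x, ‖x‖ = r → |h x| ≤ Real.sqrt (F x) * Real.sqrt (G x) := by
    intro x hx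
    rw [← Real.sqrt_mul (hF0 x hx), ← Real.sqrt_sq_eq_abs]
    exact Real.sqrt_le_sqrt (hpt x hx)
  have h1 : |sphereIntegral (volume : Measure 𝔼) h r| ≤
      sphereIntegral (volume : Measure 𝔼) (fun x => Real.sqrt (F x) * Real.sqrt (G x)) r := by
    have hup : sphereIntegral (volume : Measure 𝔼) h r ≤
        sphereIntegral (volume : Measure 𝔼) (fun x => Real.sqrt (F x) * Real.sqrt (G x)) r :=
      sphereIntegral_mono_of_norm hh (hsF.mul hsG) hr fun x hx => (le_abs_self _).trans (habs x hx)
    have hdown : sphereIntegral (volume : Measure 𝔼) (fun x => -h x) r ≤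
        sphereIntegral (volume : Measure 𝔼) (fun x => Real.sqrt (F x) * Real.sqrt (G x)) r :=
      sphereIntegral_mono_of_norm hh.neg (hsF.mul hsG) hr fun x hx => (neg_le_abs _).trans (habs x hx)
    have hneg : sphereIntegral (volume : Measure 𝔼) (fun x => -h x) r = -sphereIntegral (volume : Measure 𝔼) h r := by
      rw [sphereIntegral_def, sphereIntegral_def, integral_neg]
    rw [hneg] at hdown
    exact abs_le.2 ⟨by linarith, hup⟩
  have h2 := sphereIntegral_mul_sq_le hsF hsG hr
  have hF2 : sphereIntegral (volume : Measure 𝔼) (fun x => Real.sqrt (F x) ^ 2) r = sphereIntegral (volume : Measure 𝔼) F r :=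
    sphereIntegral_congr_norm hr.le fun x hx => Real.sq_sqrt (hF0 x hx)
  have hG2 : sphereIntegral (volume : Measure 𝔼) (fun x => Real.sqrt (G x) ^ 2) r = sphereIntegral (volume : Measure 𝔼) G r :=
    sphereIntegral_congr_norm hr.le fun x hx => Real.sq_sqrt (hG0 x hx)
  rw [hF2, hG2] at h2
  have h3 : (sphereIntegral (volume : Measure 𝔼) h r) ^ 2 ≤
      (sphereIntegral (volume : Measure 𝔼) (fun x => Real.sqrt (F x) * Real.sqrt (G x)) r) ^ 2 :=
    sq_le_sq' (abs_le.1 h1).1 (abs_le.1 h1).2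
  exact h3.trans h2

/-- **The nonlinear term**: `|∮∑⟨u_a, N_a⟩| ≤ 256 (ε/r) √(∮∑‖u_a‖²) √(∮∑∑‖F_{cd}‖²)` on `S_r` under the
shell curvature bound. [folklore] -/
theorem abs_sphereIntegral_nonlin_le {B : Connection 𝔼 𝔤} (hB : ContDiff ℝ 3 B) {r ε : ℝ} (hr : 0 < r)
    (hε : 0 ≤ ε) (hF : ShellCurvatureBound B r ε) :
    |sphereIntegral (volume : Measure 𝔼) (fun x => ∑ a, ⟪hodgeSec 𝕓 B a x, hodgeNonlin 𝕓 B a x⟫) r| ≤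
      256 * (ε / r) * √(sphereIntegral (volume : Measure 𝔼) (fun x => ∑ a, ‖hodgeSec 𝕓 B a x‖ ^ 2) r) *
        √(sphereIntegral (volume : Measure 𝔼) (fun x => ∑ c, ∑ d, ‖curvature B x (𝕓 c) (𝕓 d)‖ ^ 2) r) := by
  haveI : Nontrivial 𝔼 := inferInstance
  have hB1 : ContDiff ℝ 1 B := hB.of_le (by norm_num)
  have hu2 : ∀ a, ContDiff ℝ 2 (hodgeSec 𝕓 B a) := fun a => contDiff_hodgeSec hB a
  have hNc : ∀ a, Continuous (hodgeNonlin 𝕓 B a) := fun a => continuous_hodgeNonlin' hB1 a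
  have hFc : ∀ c d, Continuous fun x => curvature B x (𝕓 c) (𝕓 d) := fun c d =>
    (contDiff_curvature_apply (k := 0) (by rw [show ((0 : WithTop ℕ∞) + 1) = 1 by norm_num]; exact hB1) _ _).continuous
  have hh : Continuous fun x => ∑ a, ⟪hodgeSec 𝕓 B a x, hodgeNonlin 𝕓 B a x⟫ :=
    continuous_finsetSum _ fun a _ => (hu2 a).continuous.inner (hNc a)
  have hFf : Continuous fun x : 𝔼 => (256 * (ε / r)) ^ 2 * ∑ a, ‖hodgeSec 𝕓 B a x‖ ^ 2 :=
    continuous_const.mul (continuous_finsetSum _ fun a _ => ((hu2 a).continuous.norm).pow 2)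
  have hGg : Continuous fun x : 𝔼 => ∑ c, ∑ d, ‖curvature B x (𝕓 c) (𝕓 d)‖ ^ 2 :=
    continuous_finsetSum _ fun c _ => continuous_finsetSum _ fun d _ => ((hFc c d).norm).pow 2
  have hpt : ∀ x : 𝔼, ‖x‖ = r → (∑ a, ⟪hodgeSec 𝕓 B a x, hodgeNonlin 𝕓 B a x⟫) ^ 2 ≤
      ((256 * (ε / r)) ^ 2 * ∑ a, ‖hodgeSec 𝕓 B a x‖ ^ 2) * ∑ c, ∑ d, ‖curvature B x (𝕓 c) (𝕓 d)‖ ^ 2 := by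
    intro x hx
    have hFx : ∀ v w : 𝔼, ‖curvature B x v w‖ ≤ ε / r ^ 2 * ‖v‖ * ‖w‖ :=
      hF x (by rw [hx]; linarith) (by rw [hx]; linarith)
    exact sq_sum_inner_hodgeNonlin_le 𝕓 hr hx.le hFx fun a => hodgeSec 𝕓 B a x
  have h := sphereIntegral_sq_le_of_sq_le_mul_sphere hh.continuousOn hFf.continuousOn hGg.continuousOn hr
    (fun x _ => by positivity) (fun x _ => Finset.sum_nonneg fun c _ => Finset.sum_nonneg fun d _ => sq_nonneg _) hpt
  rw [sphereIntegral_mul_left] at h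
  -- take square roots
  have hU0 : 0 ≤ sphereIntegral (volume : Measure 𝔼) (fun x => ∑ a, ‖hodgeSec 𝕓 B a x‖ ^ 2) r :=
    sphereIntegral_nonneg' (fun x => Finset.sum_nonneg fun a _ => sq_nonneg _) r
  have hW0 : 0 ≤ sphereIntegral (volume : Measure 𝔼) (fun x => ∑ c, ∑ d, ‖curvature B x (𝕓 c) (𝕓 d)‖ ^ 2) r :=
    sphereIntegral_nonneg' (fun x => Finset.sum_nonneg fun c _ => Finset.sum_nonneg fun d _ => sq_nonneg _) r
  have hM0 : 0 ≤ 256 * (ε / r) := by positivity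
  rw [← Real.sqrt_sq (abs_nonneg _), ← Real.sqrt_sq hM0, ← Real.sqrt_mul (sq_nonneg _), ← Real.sqrt_mul
    (mul_nonneg (sq_nonneg _) hU0)]
  refine Real.sqrt_le_sqrt ?_
  rw [sq_abs]
  nlinarith [h]

/-! ### The differential inequality -/

set_option maxHeartbeats 1600000 in
/-- **Waldron's `f₁`-inequality, regularized** (`F₁ = ρ √(q + δ)`, `q = ∮_{S_ρ} ∑ₐ‖u_a‖²`): along the
flow, at `(t, r)` with the shell curvature bound `ε/r²` (`0 < ε ≤ ε₂(N)`),
`∂ₜF₁ ≤ ∂ᵣ²F₁ + ∂ᵣF₁/r − (4 − 307 C_N ε) F₁/r² + 3√δ/r + 256 ε (∮_{S_r}∑_{cd}‖F_{cd}‖²)^{1/2}`.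
[cite: Waldron2019, §4.2, Proposition 4.3 / (4.11), `□ f₁ ≤ C e f / r²`] -/
theorem f1_differential_inequality [NeZero N] {A : ℝ → Connection 𝔼 𝔤} {𝒯 : Set ℝ} (h𝒯 : IsOpen 𝒯)
    (hA : ContDiffOn ℝ ∞ (fun p : ℝ × 𝔼 => A p.1 p.2) (𝒯 ×ˢ (univ : Set 𝔼)))
    (hpde : ∀ ⦃s : ℝ⦄, s ∈ 𝒯 → ∀ y w, deriv (fun s' => A s' y w) s = divCurvature (A s) y w)
    (hval : ∀ ⦃s : ℝ⦄, s ∈ 𝒯 → (A s).IsValuedIn (skewAdjoint.submodule ℝ 𝔤))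
    {t : ℝ} (ht : t ∈ 𝒯) {r δ ε : ℝ} (hr : 0 < r) (hδ : 0 < δ) (hε0 : 0 < ε) (hε2 : ε ≤ epsTwo N)
    (hF : ShellCurvatureBound (A t) r ε) :
    ∃ Ft Fr Frr : ℝ,
      HasDerivAt (fun s => r * √(sphereIntegral (volume : Measure 𝔼)
        (fun x => ∑ a, ‖hodgeSec 𝕓 (A s) a x‖ ^ 2) r + δ)) Ft t ∧
      HasDerivAt (fun ρ => ρ * √(sphereIntegral (volume : Measure 𝔼)
        (fun x => ∑ a, ‖hodgeSec 𝕓 (A t) a x‖ ^ 2) ρ + δ)) Fr r ∧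
      HasDerivAt (fun ρ => deriv (fun ρ' => ρ' * √(sphereIntegral (volume : Measure 𝔼)
        (fun x => ∑ a, ‖hodgeSec 𝕓 (A t) a x‖ ^ 2) ρ' + δ)) ρ) Frr r ∧
      Ft ≤ Frr + Fr / r -
          (4 - 307 * (gapGlueConst N * ε)) * (r * √(sphereIntegral (volume : Measure 𝔼)
            (fun x => ∑ a, ‖hodgeSec 𝕓 (A t) a x‖ ^ 2) r + δ)) / r ^ 2 +
        3 * √δ / r +
        256 * ε * √(sphereIntegral (volume : Measure 𝔼)
          (fun x => ∑ c, ∑ d, ‖curvature (A t) x (𝕓 c) (𝕓 d)‖ ^ 2) r) := by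
  haveI : Nontrivial 𝔼 := inferInstance
  -- ### the fixed-time connection and its regularity
  have hO : IsOpen (𝒯 ×ˢ (univ : Set 𝔼)) := h𝒯.prod isOpen_univ
  have hBinf : ContDiff ℝ ∞ (A t) := by
    have hsl : ContDiffOn ℝ ∞ (fun y : 𝔼 => A t y) univ := by
      have hcomp : ContDiffOn ℝ ∞ ((fun p : ℝ × 𝔼 => A p.1 p.2) ∘ fun y : 𝔼 => (t, y)) univ :=
        hA.comp (contDiff_prodMk_right t).contDiffOn fun y _ => mk_mem_prod ht (mem_univ y)
      exact hcomp
    exact contDiffOn_univ.1 hsl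
  have hB4 : ContDiff ℝ 4 (A t) := hBinf.of_le (WithTop.coe_le_coe.2 le_top)
  have hB3 : ContDiff ℝ 3 (A t) := hBinf.of_le (WithTop.coe_le_coe.2 le_top)
  have hB1 : ContDiff ℝ 1 (A t) := hBinf.of_le (WithTop.coe_le_coe.2 le_top)
  have hvt := hval ht
  have hskew : IsSkewValued (A t) := isSkewValued_of_isValuedIn hvt
  have hu2 : ∀ a, ContDiff ℝ 2 (hodgeSec 𝕓 (A t) a) := fun a => contDiff_hodgeSec hB3 a
  -- ### the real quantities
  -- `q` as a function of the radius at time `t`, and its derivative function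
  set q : ℝ → ℝ := sphereIntegral (volume : Measure 𝔼) (fun x => ∑ a, ‖hodgeSec 𝕓 (A t) a x‖ ^ 2) with hq_def
  set q₁ : ℝ → ℝ := fun ρ => ρ⁻¹ * sphereIntegral (volume : Measure 𝔼)
    (fun x => fderiv ℝ (fun y => ∑ a, ‖hodgeSec 𝕓 (A t) a y‖ ^ 2) x x) ρ with hq₁_def
  obtain ⟨U, hU⟩ : ∃ U, U = q r := ⟨_, rfl⟩
  obtain ⟨P, hP⟩ : ∃ P, P = sphereIntegral (volume : Measure 𝔼)
    (fun x => fderiv ℝ (fun y => ∑ a, ‖hodgeSec 𝕓 (A t) a y‖ ^ 2) x x) r := ⟨_, rfl⟩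
  obtain ⟨R, hR⟩ : ∃ R, R = sphereIntegral (volume : Measure 𝔼)
    (fun x => ∑ a, ‖covDeriv (A t) (hodgeSec 𝕓 (A t) a) x x‖ ^ 2) r := ⟨_, rfl⟩
  obtain ⟨S2, hS2⟩ : ∃ S2, S2 = sphereIntegral (volume : Measure 𝔼) (fun x => 2 * ∑ a,
    (‖covDeriv (A t) (hodgeSec 𝕓 (A t) a) x x‖ ^ 2 +
      ⟪hodgeSec 𝕓 (A t) a x, covDeriv (A t) (fun y => covDeriv (A t) (hodgeSec 𝕓 (A t) a) y x) x x⟫)) r := ⟨_, rfl⟩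
  obtain ⟨X, hX⟩ : ∃ X, X = (1 / 2) * ∑ i, ∑ j, ∑ a, sphereIntegral (volume : Measure 𝔼)
    (fun x => ‖covDeriv (A t) (hodgeSec 𝕓 (A t) a) x (angularField 𝕓 i j x)‖ ^ 2) r := ⟨_, rfl⟩
  obtain ⟨Nl, hNl⟩ : ∃ Nl, Nl = sphereIntegral (volume : Measure 𝔼)
    (fun x => ∑ a, ⟪hodgeSec 𝕓 (A t) a x, hodgeNonlin 𝕓 (A t) a x⟫) r := ⟨_, rfl⟩
  obtain ⟨V, hV⟩ : ∃ V, V = sphereIntegral (volume : Measure 𝔼) (fun x => 2 * ∑ a, ⟪hodgeSec 𝕓 (A t) a x,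
    ∑ i, covDeriv (A t) (fun y => covDeriv (A t) (hodgeSec 𝕓 (A t) a) y (𝕓 i)) x (𝕓 i) +
      hodgeNonlin 𝕓 (A t) a x⟫) r := ⟨_, rfl⟩
  obtain ⟨W, hW⟩ : ∃ W, W = sphereIntegral (volume : Measure 𝔼)
    (fun x => ∑ c, ∑ d, ‖curvature (A t) x (𝕓 c) (𝕓 d)‖ ^ 2) r := ⟨_, rfl⟩
  -- ### signs
  have hU0 : 0 ≤ U := by rw [hU]; exact sphereIntegral_nonneg' (fun x => Finset.sum_nonneg fun a _ => sq_nonneg _) r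
  have hR0 : 0 ≤ R := by rw [hR]; exact sphereIntegral_nonneg' (fun x => Finset.sum_nonneg fun a _ => sq_nonneg _) r
  have hX0 : 0 ≤ X := by
    rw [hX]
    refine mul_nonneg (by norm_num) (Finset.sum_nonneg fun i _ => Finset.sum_nonneg fun j _ =>
      Finset.sum_nonneg fun a _ => sphereIntegral_nonneg' (fun x => sq_nonneg _) r)
  have hW0 : 0 ≤ W := by
    rw [hW]; exact sphereIntegral_nonneg' (fun x => Finset.sum_nonneg fun c _ => Finset.sum_nonneg fun d _ => sq_nonneg _) r
  have hκ0 : 0 ≤ gapGlueConst N * ε := mul_nonneg (gapGlueConst_pos (N := N)).le hε0.le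
  have hpos : 0 < q r + δ := by rw [← hU]; linarith
  have hψ : 0 < √(q r + δ) := Real.sqrt_pos.2 hpos
  -- ### the three analytic inputs
  -- identity
  have hid : r ^ 2 * V = -2 * X + (S2 - 2 * R) + 3 * P + 2 * r ^ 2 * Nl := by
    have h := sphereEnergy_time_identity hB3 hvt hr
    rw [sphereIntegral_sum_angSq hB1 hu2 hr] at h
    rw [hV, hX, hS2, hR, hP, hNl, h]
    ring
  -- gap
  have hgap : 3 * U ≤ (1 + gapGlueConst N * ε) * X + 304 * (gapGlueConst N * ε) * U := by
    have h := sphere_covariant_gap_invariant hB4 hskew hr hε0 hε2 hF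
    rw [← sphereIntegral_sum_normSq (fun a => (hu2 a).continuous) hr] at h
    rw [hU, hX]; exact h
  -- Cauchy–Schwarz
  have hCS : P ^ 2 ≤ 4 * U * R := by
    have h := radial_cauchySchwarz hB1 hu2 hr
    have hPeq : P = sphereIntegral (volume : Measure 𝔼)
        (fun x => 2 * ∑ a, ⟪hodgeSec 𝕓 (A t) a x, covDeriv (A t) (hodgeSec 𝕓 (A t) a) x x⟫) r := by
      rw [hP]; exact sphereIntegral_congr_norm hr.le fun x _ => fderiv_sphereEnergyDensity hB3 hvt x x
    rw [hPeq, hU, hR]; exact h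
  -- ### the `ψ`-inequality
  have hψineq := psi_heat_inequality (δ := δ) hr hδ hU0 hX0 hR0 hκ0 hid hgap hCS
  rw [hU] at hψineq
  -- ### derivatives of `q`, `ψ = √(q + δ)` and `F₁ = ρ ψ`
  have hq_all : ∀ ρ : ℝ, 0 < ρ → HasDerivAt q (q₁ ρ) ρ := fun ρ hρ => hasDerivAt_sphereEnergy hB3 hρ
  have hq_ev : ∀ᶠ ρ in 𝓝 r, HasDerivAt q (q₁ ρ) ρ :=
    (eventually_gt_nhds hr).mono fun ρ hρ => hq_all ρ hρ
  have hq₁r : q₁ r = 2 * (P / (2 * r)) := by rw [hq₁_def, hP]; field_simp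
  have hq₁ : HasDerivAt q₁ (2 * (R / r ^ 2 + (S2 - 2 * R) / (2 * r ^ 2))) r := by
    have h := hasDerivAt_sphereEnergy_deriv hB3 hvt hr
    rw [← hS2] at h
    convert h using 1
    field_simp
    ring
  -- `ψ`
  have hψ1 : HasDerivAt (fun ρ => √(q ρ + δ)) (q₁ r / (2 * √(q r + δ))) r :=
    hasDerivAt_sqrt_add_const (hq_all r hr) hpos
  have hψ1_all : ∀ ρ : ℝ, 0 < ρ → HasDerivAt (fun ρ' => √(q ρ' + δ)) (q₁ ρ / (2 * √(q ρ + δ))) ρ := by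
    intro ρ hρ
    have hposρ : 0 < q ρ + δ := by
      have : 0 ≤ q ρ := sphereIntegral_nonneg' (fun x => Finset.sum_nonneg fun a _ => sq_nonneg _) ρ
      linarith
    exact hasDerivAt_sqrt_add_const (hq_all ρ hρ) hposρ
  have hψ2 : HasDerivAt (fun ρ => q₁ ρ / (2 * √(q ρ + δ)))
      ((R / r ^ 2 + (S2 - 2 * R) / (2 * r ^ 2)) / √(q r + δ) - (P / (2 * r)) ^ 2 / (√(q r + δ)) ^ 3) r :=
    hasDerivAt_deriv_sqrt_add_const hq_ev hq₁r hq₁ hpos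
  -- time derivative of `ψ`
  have hqt : HasDerivAt (fun s => sphereIntegral (volume : Measure 𝔼)
      (fun x => ∑ a, ‖hodgeSec 𝕓 (A s) a x‖ ^ 2) r) V t := by
    rw [hV]; exact hasDerivAt_sphereEnergy_time h𝒯 hA hpde ht hr
  have hψt : HasDerivAt (fun s => √(sphereIntegral (volume : Measure 𝔼)
      (fun x => ∑ a, ‖hodgeSec 𝕓 (A s) a x‖ ^ 2) r + δ)) (V / (2 * √(q r + δ))) t :=
    hasDerivAt_sqrt_add_const (q := fun s => sphereIntegral (volume : Measure 𝔼)
      (fun x => ∑ a, ‖hodgeSec 𝕓 (A s) a x‖ ^ 2) r) hqt hpos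
  -- `F₁ = ρ ψ`
  set ψ1v : ℝ := q₁ r / (2 * √(q r + δ)) with hψ1v
  set ψ2v : ℝ := (R / r ^ 2 + (S2 - 2 * R) / (2 * r ^ 2)) / √(q r + δ) - (P / (2 * r)) ^ 2 / (√(q r + δ)) ^ 3
    with hψ2v
  have hFr : HasDerivAt (fun ρ => ρ * √(q ρ + δ)) (1 * √(q r + δ) + r * ψ1v) r :=
    (hasDerivAt_id' r).mul hψ1
  have hderiv_ev : deriv (fun ρ' => ρ' * √(q ρ' + δ)) =ᶠ[𝓝 r] fun ρ => √(q ρ + δ) + ρ * (q₁ ρ / (2 * √(q ρ + δ))) := by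
    refine (eventually_gt_nhds hr).mono fun ρ hρ => ?_
    have h : HasDerivAt (fun ρ' => ρ' * √(q ρ' + δ)) (1 * √(q ρ + δ) + ρ * (q₁ ρ / (2 * √(q ρ + δ)))) ρ :=
      (hasDerivAt_id' ρ).mul (hψ1_all ρ hρ)
    rw [h.deriv]; simp
  have hFrr : HasDerivAt (fun ρ => deriv (fun ρ' => ρ' * √(q ρ' + δ)) ρ) (ψ1v + (1 * ψ1v + r * ψ2v)) r := by
    refine HasDerivAt.congr_of_eventuallyEq ?_ hderiv_ev
    exact hψ1.add ((hasDerivAt_id' r).mul hψ2)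
  have hFt : HasDerivAt (fun s => r * √(sphereIntegral (volume : Measure 𝔼)
      (fun x => ∑ a, ‖hodgeSec 𝕓 (A s) a x‖ ^ 2) r + δ)) (r * (V / (2 * √(q r + δ)))) t :=
    hψt.const_mul r
  refine ⟨r * (V / (2 * √(q r + δ))), 1 * √(q r + δ) + r * ψ1v, ψ1v + (1 * ψ1v + r * ψ2v), hFt, hFr, hFrr, ?_⟩
  -- ### the inequality
  have hψ1v' : ψ1v = (P / (2 * r)) / √(q r + δ) := by rw [hψ1v, hq₁r]; ring
  have hF1 := F1_heat_inequality (ψ := √(q r + δ)) (ψt := V / (2 * √(q r + δ))) (ψ1 := (P / (2 * r)) / √(q r + δ))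
    (ψ2 := ψ2v) (κ := gapGlueConst N * ε) (δs := 3 * √δ) (E := r ^ 2 * |Nl| / √(q r + δ)) hr
    (by rw [hψ2v]; linarith [hψineq])
  -- the nonlinear term: `r |Nl|/ψ ≤ 256 ε √W`
  have hE : r ^ 2 * |Nl| / √(q r + δ) / r ≤ 256 * ε * √W := by
    have hNlb : |Nl| ≤ 256 * (ε / r) * √U * √W := by
      rw [hNl, hU, hW]; exact abs_sphereIntegral_nonlin_le hB3 hr hε0.le hF
    have hUψ : √U ≤ √(q r + δ) := by rw [hU]; exact Real.sqrt_le_sqrt (by linarith)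
    have h1 : r ^ 2 * |Nl| / √(q r + δ) / r = r * (|Nl| / √(q r + δ)) := by
      field_simp
    rw [h1]
    have h2 : |Nl| / √(q r + δ) ≤ 256 * (ε / r) * √W := by
      rw [div_le_iff₀ hψ]
      calc |Nl| ≤ 256 * (ε / r) * √U * √W := hNlb
        _ = 256 * (ε / r) * √W * √U := by ring
        _ ≤ 256 * (ε / r) * √W * √(q r + δ) :=
            mul_le_mul_of_nonneg_left hUψ (by positivity)
    calc r * (|Nl| / √(q r + δ)) ≤ r * (256 * (ε / r) * √W) := mul_le_mul_of_nonneg_left h2 hr.le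
      _ = 256 * ε * √W := by field_simp
  rw [← hW]
  have e1 : (1 : ℝ) * √(q r + δ) + r * ψ1v = √(q r + δ) + r * ((P / (2 * r)) / √(q r + δ)) := by
    rw [hψ1v']; ring
  have e2 : ψ1v + (1 * ψ1v + r * ψ2v) = 2 * ((P / (2 * r)) / √(q r + δ)) + r * ψ2v := by rw [hψ1v']; ring
  rw [e1, e2]
  linarith [hF1, hE]

end Literature.MathematicalPhysics.QuantumLattice
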